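import Summits.QuantumFields.YangMills.Theorems.BalabanUVNodesN11TStepOfRecordSeparated
import Summits.QuantumFields.YangMills.Theorems.BalabanUVNodesN11TkFibreReading
import Summits.QuantumFields.YangMills.Theorems.BalabanUVNodesN11AveragingSkewPresentationAtRecord

/-!
# DAG node N11 — THE `genOp` JUNCTION BY NAME: def-T's (†) ∕ the represented tower's pre-𝐑 slot, through the bond-partition presentation, IS 11a's GENERATION OF RECORD
# `genOp k (genDataOfRecord … s′ S k)` at the presented point — modulo the inner reading and the INNER IDENTIFICATION ON THE AVERAGING FIBRE

HEADER — WORK-UNIT METADATA.  Cell `pub-ymgap`, YM-PLAN Track A (HUMAN RULING D-0062), seat `pub-ymgap-dag-n11-d` (g14; R134 fan-out base seat N11 [B14], strategy s2),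
route `BalabanUVNodes` rev 25, item K1⁷ `StabilityBAtRecordR13SepCoPH` = stmt-QuantumFields-20542 (helper lane, `--kind proof --supports 20542 --as helper`, count-neutral).
[III] = [Balaban1988Convergent].  Sequel of this seat's `…N11TStepOfRecordSeparated` (INTENT-5: ★★★★ `slotsTOfRecord_succ_comp_glue_ae_eq_kernelRTOfRecord_bondsIn`,
`tstepOfRecord_comp_glue_ae_eq_kernelRTOfRecord_bondsIn` — the LEFT side of (O3′) through the presentation = 11a's `kernelRTOfRecord` on the inner reading) and of this
lineage's `…N11TkFibreReading` (★ `kernelRT_ae_congr_of_fibre` — 11a's restricted kernel transport reads its integrand only on the averaging fibre, product-Haar-a.e.) and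
dag-n11-e g21's `…N11AveragingSkewPresentationAtRecord` (p615032: `toFine_mem_compl_Omega_iff` — the saturation `hY` at def-R's regions of record is a theorem), over
11a `Node00/TkOfRecord` §1–§3 (`genOp`, `vOp`, `zetaOp`, `aOp`, `GenData`, `genDataOfRecord`, `kernelRTOfRecord`; `genOp_apply`, `vOp_apply` are `rfl`).  INTENT-6 I.31579.

WHY THIS FILE.  11a's one generation of (2.21), `genOp k D Φ ω = D.vT (y ↦ (ζ · aOp k D.sA D.w Φ)(ω_y)) (ω_{k+1}|_{D.sV'})` with `ω_y := update ω k (updateFinset (ω k).1 D.sV y, (ω k).2)`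
(`genOp_apply`, `vOp_apply`), has at `D := genDataOfRecord F N V ν M g K W s′ S k` the V-factor `D.vT = kernelRTOfRecord F N K k D.sV D.sV'` ON THE NOSE, `D.sV ∕ D.sV'` being the
level-`k` ∕ level-`(k+1)` bonds of `(Ω_{k+1}(s′))ᶜ`.  INTENT-5 delivered `(slotsT_{k+1}(s′)) ∘ e_α =ᵐ q ↦ kernelRTOfRecord … D.sV D.sV' (y ↦ Fᵢ (y, q.2)) q.1` for a displayed inner
reading `Fᵢ`.  So the (†) = `𝐓^{(k)}` junction BY NAME reduces to two readings of the SAME restricted transport at the SAME coarse point `q.1`: they agree as soon as the two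
integrands agree ON THE AVERAGING FIBRE `{y | avgRestrOfRecord … y = q.1}` (this lineage's a.e. fibre congruence) — which is the DISPLAYED INNER IDENTIFICATION `hinner`:
on the fibre, the inner reading `Fᵢ (y, q.2)` IS `ζ(ω_y) · (aOp k D.sA D.w Φ)(ω_y)` at a configuration family `ωOf q` pinned at scale `k+1` to the presented point (`hω`).  `hinner` is
exactly where [III] (3.10)–(3.23) (background field, [I] §2's change of variables with its Jacobian, the conditional Gaussian normalisation `ζ`, the fluctuation integral `aOp`) live —
the chart seats' deliverable; NOTHING of it is proved here.

WHAT THIS FILE PROVES (0 `def`, 0 `sorry`, standard axioms).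
§1 ★★ `kernelRTOfRecord_congr_of_fibre_ae_prod` — for `(Π_{sV'} Haar ⊗ μ_r)`-a.e. presented coarse point `q`, integrands agreeing on `avgRestrOfRecord⁻¹{q.1}` have the same
   `kernelRTOfRecord sV sV'`-image at `q.1` (`kernelRT_ae_congr_of_fibre` along `quasiMeasurePreserving_fst`).
§2 ★★★★★ `tstepOfRecord_comp_glue_ae_eq_genOp_genDataOfRecord` · ★★★★★ `slotsTOfRecord_succ_comp_glue_ae_eq_genOp_genDataOfRecord` —
   `(tstepOfRecord … k T s′) ∘ e_α =ᵐ[Π_{sV'} Haar ⊗ Π_{sV'ᶜ} Haar] q ↦ genOp k (genDataOfRecord F N V ν M g K W s′ S k) Φ (ωOf q)` (likewise `slotsTOfRecord … (k+1) s′`), modulo `hG`, `hin` (INTENT-5)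
   and `hω`, `hinner` (this file); the saturation `hY` at `(Ω_{k+1}(s′))ᶜ` is DISCHARGED by dag-n11-e's `toFine_mem_compl_Omega_iff` (p615032) — def-T's value-level T-step = 11a's `𝐓^{(k)}` of record at the presented point, the shape of `tkBranchOfRecord_succ` ∕ `atScale_succ`.
   ★★★★★ `slotsTOfRecord₁₃H_succ_comp_glue_ae_eq_genOp_genDataOfRecord` — the same in the Stage-13 letters of (O3′) (`θ : Stage13HParams F N`: `θ.ν, θ.τ9, EOfRecord₁₃, wOfRecord₉, θ.ppSel, gOfRecord₁₃`).

HONEST FRAMING.  Helper lane of K1⁷; count-neutral; kernel bookkeeping BY NAME over def-T's ∕ 11a's definitions; `hG`, `hin`, `hω`, `hinner` are DISPLAYED hypotheses (`hY` discharged by dag-n11-e's p615032); the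
operand `Φ`, the configuration family `ωOf`, the weights `W` and the branch `S` are ARBITRARY (no claim that any particular choice satisfies `hinner`); NO chart of Bałaban's, NO
Jacobian, NO Gaussian integration, nothing of [I] §2 ∕ [III] §3 asserted; (B4) ∕ (S-α) ∕ (O3′) NOT closed; N11 NOT discharged; K1⁷ NOT closed; counts unmoved (typed 28∕28 ·
discharged 5∕27 · A 5∕28).  One finite `𝕋⁴_{L^K}` programme at fixed `ε = L^{−K}`; R4 closes only the conditional finite-𝕋⁴ rung `BalabanLadder.UV` — NOT ℝ⁴, NOT OS, NOT a mass
gap, NOT Clay.  No `sorry`, `axiom`, `def`, `instance`, `notation`.  Sources (SHAPE ∕ bookkeeping only): [III] (2.18) p.257, (2.20)–(2.21) p.258, (3.1) p.264, (3.23)–(3.25) p.270.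
-/

noncomputable section

open MeasureTheory ProbabilityTheory
open scoped ENNReal NNReal

namespace Summit.QuantumFields.YangMills.Theorems.BalabanUVNodesN11TStepGenOpJunction

open Literature.MathematicalPhysics.QuantumFieldTheory.Balaban1983to89
open Literature.MathematicalPhysics.QuantumFieldTheory.Balaban1983to89.T4AveragingDisintegration
open BalabanUVNodesN11TStepOfRecordSeparated (tstepOfRecord_comp_glue_ae_eq_kernelRTOfRecord_bondsIn slotsTOfRecord_succ_comp_glue_ae_eq_kernelRTOfRecord_bondsIn)
open BalabanUVNodesN11TkFibreReading (kernelRT_ae_congr_of_fibre)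
open BalabanUVNodesN11AveragingSkewPresentationAtRecord (toFine_mem_compl_Omega_iff)
open Node00 hiding SU
open Node00.Tk T4Continuum
open B10Eq42TorusConstraint (bondsIn)
open B10Eq38TorusDomains (toFine)

variable {F : T4Family} {N : ℕ} [NeZero N]

/-! ## §1  11a's restricted transport of record reads its integrand only on the averaging fibre, a.e. in the presented coarse point -/

section Fibre

/-- ★★ **FIBRE CONGRUENCE OF 11a's RESTRICTED TRANSPORT OF RECORD, a.e. IN THE PRESENTED COARSE POINT**: for `(Π_{sV'} Haar ⊗ μ_r)`-almost every `q`, any two integrands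
agreeing on the averaging fibre `{y | avgRestrOfRecord … y = q.1}` have the same `kernelRTOfRecord sV sV'`-image at `q.1` (this lineage's `kernelRT_ae_congr_of_fibre`, pulled
back along the first projection; any s-finite `μ_r`). [cite: Balaban1988Convergent, (2.21) p.258 (bookkeeping)] -/
theorem kernelRTOfRecord_congr_of_fibre_ae_prod (K k : ℕ) [DecidableEq (PBond (F.P K) k)] (sV : Finset (PBond (F.P K) k)) (sV' : Finset (PBond (F.P K) (k + 1)))
    {R : Type*} [MeasurableSpace R] (μr : Measure R) :
    ∀ᵐ q ∂((Measure.pi fun _ : ↥sV' => (HaarData.haar : Measure (SU N))).prod μr),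
      ∀ f f' : (↥sV → SU N) → ℝ, (∀ y, avgRestrOfRecord F N K k sV sV' y = q.1 → f y = f' y) →
        kernelRTOfRecord F N K k sV sV' f q.1 = kernelRTOfRecord F N K k sV sV' f' q.1 := by
  haveI : MeasurableEq (↥sV' → SU N) := inferInstance
  exact Measure.quasiMeasurePreserving_fst.ae
    (kernelRT_ae_congr_of_fibre (G := SU N) (measurable_avgRestrOfRecord (F := F) (N := N) K k sV sV'))

end Fibre

/-! ## §2  The junction: (†) ∕ the pre-𝐑 slot through the presentation = 11a's generation of record at the presented point -/

section Junction

variable {V : Type} [NormedAddCommGroup V] [InnerProductSpace ℝ V] [FiniteDimensional ℝ V] [MeasurableSpace V] [BorelSpace V]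

/-- ★★★★★ **def-T's VALUE-LEVEL T-STEP (†), THROUGH THE BOND-PARTITION PRESENTATION AT `Y = (Ω_{k+1}(s′))ᶜ`, IS 11a's GENERATION OF RECORD `genOp k (genDataOfRecord … s′ S k)`
AT THE PRESENTED POINT** — for any level-`k` slot family `T`, weights `W`, branch `S`, operand `Φ` and configuration family `ωOf` pinned at scale `k+1` (`hω`; the saturation of
`(Ω_{k+1}(s′))ᶜ` is dag-n11-e's `toFine_mem_compl_Omega_iff`), MODULO the
displayed inner reading `hin` of the graph integrand (INTENT-5) and the displayed inner identification on the averaging fibre `hinner`: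
`(tstepOfRecord … k T s′) ∘ e_α =ᵐ[Π_{sV'} Haar ⊗ Π_{sV'ᶜ} Haar] q ↦ genOp k (genDataOfRecord F N V ν M g K W s′ S k) Φ (ωOf q)`.
Proof: INTENT-5's `_bondsIn` face, then `genOp_apply` ∕ `vOp_apply` (`rfl`), `hω`, and §1's fibre congruence fed `hinner`.
[cite: Balaban1988Convergent, (2.20)–(2.21) p.258, (3.1) p.264, (3.24)–(3.25) p.270 (bookkeeping)] -/
theorem tstepOfRecord_comp_glue_ae_eq_genOp_genDataOfRecord (ν : Stage7Numerics) (M : ℕ) (w : StepWeightsOfRecord F N ν M) (p : B12.RunParams) (g : ℕ → ℝ)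
    {k : ℕ} (hkK : k < p.K) [DecidableEq (PBond (F.P p.K) k)] [DecidableEq (PBond (F.P p.K) (k + 1))] (hk : k + 1 ≤ (F.P p.K).m + (F.P p.K).K)
    (T : SeqOfRecord F ν M g p.K k → Density (F.P p.K) k (SU N)) (s' : SeqOfRecord F ν M g p.K (k + 1)) (W : TkWeights F N V p.K)
    (S : ℕ → Set (Site (F.P p.K) 0))
    (hG : Integrable (fun U => w p g k s' U ((avOfRecord F N p.K k).avg U) * (chiSeqOfRecord F N ν M g p.K k s'.init U * T s'.init U))
      (fieldMeasure (F.P p.K) k (SU N)))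
    {Fᵢ : (↥(Set.toFinite (bondsIn k (s'.Ω (k + 1))ᶜ)).toFinset → SU N) ×
        ({c : PBond (F.P p.K) (k + 1) // c ∉ (Set.toFinite (bondsIn (k + 1) (s'.Ω (k + 1))ᶜ)).toFinset} → SU N) → ℝ} (hFm : Measurable Fᵢ)
    (hin : kernelTransport
        ((Measure.pi fun _ : ↥(Set.toFinite (bondsIn k (s'.Ω (k + 1))ᶜ)).toFinset => (HaarData.haar : Measure (SU N))).prod
          (Measure.pi fun _ : {b : PBond (F.P p.K) k // b ∉ (Set.toFinite (bondsIn k (s'.Ω (k + 1))ᶜ)).toFinset} => (HaarData.haar : Measure (SU N))))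
        ((Measure.pi fun _ : ↥(Set.toFinite (bondsIn k (s'.Ω (k + 1))ᶜ)).toFinset => (HaarData.haar : Measure (SU N))).prod
          (Measure.pi fun _ : {c : PBond (F.P p.K) (k + 1) // c ∉ (Set.toFinite (bondsIn (k + 1) (s'.Ω (k + 1))ᶜ)).toFinset} =>
            (HaarData.haar : Measure (SU N))))
        (fun q => (q.1, fun c : {c : PBond (F.P p.K) (k + 1) // c ∉ (Set.toFinite (bondsIn (k + 1) (s'.Ω (k + 1))ᶜ)).toFinset} =>
          (avOfRecord F N p.K k).avg
            ((MeasurableEquiv.piEquivPiSubtypeProd (fun _ : PBond (F.P p.K) k => SU N)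
              (· ∈ (Set.toFinite (bondsIn k (s'.Ω (k + 1))ᶜ)).toFinset)).symm q) c))
        ((fun U => w p g k s' U ((avOfRecord F N p.K k).avg U) * (chiSeqOfRecord F N ν M g p.K k s'.init U * T s'.init U)) ∘
          ⇑(MeasurableEquiv.piEquivPiSubtypeProd (fun _ : PBond (F.P p.K) k => SU N)
            (· ∈ (Set.toFinite (bondsIn k (s'.Ω (k + 1))ᶜ)).toFinset)).symm)
      =ᵐ[(Measure.pi fun _ : ↥(Set.toFinite (bondsIn k (s'.Ω (k + 1))ᶜ)).toFinset => (HaarData.haar : Measure (SU N))).prod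
          (Measure.pi fun _ : {c : PBond (F.P p.K) (k + 1) // c ∉ (Set.toFinite (bondsIn (k + 1) (s'.Ω (k + 1))ᶜ)).toFinset} =>
            (HaarData.haar : Measure (SU N)))] Fᵢ)
    (Φ : MultiCfg (F.P p.K) (SU N) V → ℝ)
    (ωOf : (↥(Set.toFinite (bondsIn (k + 1) (s'.Ω (k + 1))ᶜ)).toFinset → SU N) ×
        ({c : PBond (F.P p.K) (k + 1) // c ∉ (Set.toFinite (bondsIn (k + 1) (s'.Ω (k + 1))ᶜ)).toFinset} → SU N) → MultiCfg (F.P p.K) (SU N) V)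
    (hω : ∀ q, (fun b : ↥(genDataOfRecord F N V ν M g p.K W s' S k).sV' => ((ωOf q) (k + 1)).1 (b : PBond (F.P p.K) (k + 1))) = q.1)
    (hinner : ∀ᵐ q ∂((Measure.pi fun _ : ↥(Set.toFinite (bondsIn (k + 1) (s'.Ω (k + 1))ᶜ)).toFinset => (HaarData.haar : Measure (SU N))).prod
          (Measure.pi fun _ : {c : PBond (F.P p.K) (k + 1) // c ∉ (Set.toFinite (bondsIn (k + 1) (s'.Ω (k + 1))ᶜ)).toFinset} =>
            (HaarData.haar : Measure (SU N)))),
      ∀ y : ↥(Set.toFinite (bondsIn k (s'.Ω (k + 1))ᶜ)).toFinset → SU N,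
        avgRestrOfRecord F N p.K k (Set.toFinite (bondsIn k (s'.Ω (k + 1))ᶜ)).toFinset (Set.toFinite (bondsIn (k + 1) (s'.Ω (k + 1))ᶜ)).toFinset y = q.1 →
        Fᵢ (y, q.2) =
          zetaOp (genDataOfRecord F N V ν M g p.K W s' S k).ζ
            (aOp k (genDataOfRecord F N V ν M g p.K W s' S k).sA (genDataOfRecord F N V ν M g p.K W s' S k).w Φ)
            (Function.update (ωOf q) k
              (Function.updateFinset ((ωOf q) k).1 (genDataOfRecord F N V ν M g p.K W s' S k).sV y, ((ωOf q) k).2))) :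
    (tstepOfRecord F N ν M w p g k T s') ∘
        ⇑(MeasurableEquiv.piEquivPiSubtypeProd (fun _ : PBond (F.P p.K) (k + 1) => SU N)
          (· ∈ (Set.toFinite (bondsIn (k + 1) (s'.Ω (k + 1))ᶜ)).toFinset)).symm
      =ᵐ[(Measure.pi fun _ : ↥(Set.toFinite (bondsIn (k + 1) (s'.Ω (k + 1))ᶜ)).toFinset => (HaarData.haar : Measure (SU N))).prod
          (Measure.pi fun _ : {c : PBond (F.P p.K) (k + 1) // c ∉ (Set.toFinite (bondsIn (k + 1) (s'.Ω (k + 1))ᶜ)).toFinset} =>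
            (HaarData.haar : Measure (SU N)))]
        fun q => genOp k (genDataOfRecord F N V ν M g p.K W s' S k) Φ (ωOf q) := by
  have h5 := tstepOfRecord_comp_glue_ae_eq_kernelRTOfRecord_bondsIn ν M w p g hkK hk T s' (toFine_mem_compl_Omega_iff s' hk) hG hFm hin
  have hfib := kernelRTOfRecord_congr_of_fibre_ae_prod (F := F) (N := N) p.K k (Set.toFinite (bondsIn k (s'.Ω (k + 1))ᶜ)).toFinset
    (Set.toFinite (bondsIn (k + 1) (s'.Ω (k + 1))ᶜ)).toFinset
    (Measure.pi fun _ : {c : PBond (F.P p.K) (k + 1) // c ∉ (Set.toFinite (bondsIn (k + 1) (s'.Ω (k + 1))ᶜ)).toFinset} =>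
      (HaarData.haar : Measure (SU N)))
  filter_upwards [h5, hfib, hinner] with q hq hfq hiq
  rw [hq, genOp_apply, vOp_apply, hω q]
  exact hfq _ _ fun y hy => hiq y hy

/-- ★★★★★ **THE LEFT SIDE OF N11's (O3′), THROUGH THE PRESENTATION, IS 11a's GENERATION OF RECORD AT THE PRESENTED POINT** — the represented tower's pre-𝐑 slot
`slotsTOfRecord … (k+1) s′` (`= tstepOfRecord … k (slotsOfRecord … k) s′`, `slotsTOfRecord_succ`), modulo `hin` (INTENT-5) and `hω`, `hinner` (this file):
`(slotsTOfRecord … (k+1) s′) ∘ e_α =ᵐ[Π_{sV'} Haar ⊗ Π_{sV'ᶜ} Haar] q ↦ genOp k (genDataOfRecord F N V ν τ.M g K W s′ S k) Φ (ωOf q)` — `(𝐓_{k+1}Φ)(V′) = (𝐓^{(k)}(𝐓_kΦ))(base_{k+1} V′)`'s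
one-generation step ((3.24), `tkBranchOfRecord_succ`, `atScale_succ`) read at def-T's objects, the inner identification displayed.
[cite: Balaban1988Convergent, (2.18) p.257, (2.20)–(2.21) p.258, (3.24)–(3.25) p.270 (bookkeeping)] -/
theorem slotsTOfRecord_succ_comp_glue_ae_eq_genOp_genDataOfRecord (ν : Stage7Numerics) (τ : TowerNumerics) (E : B12.RunParams → ℝ)
    (w : StepWeightsOfRecord F N ν τ.M) (ppSel : PpSelOfRecord F ν τ.M) (p : B12.RunParams) (g : ℕ → ℝ) {k : ℕ} (hkK : k < p.K)
    [DecidableEq (PBond (F.P p.K) k)] [DecidableEq (PBond (F.P p.K) (k + 1))] (hk : k + 1 ≤ (F.P p.K).m + (F.P p.K).K) (s' : SeqOfRecord F ν τ.M g p.K (k + 1))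
    (W : TkWeights F N V p.K) (S : ℕ → Set (Site (F.P p.K) 0))
    (hG : Integrable (fun U => w p g k s' U ((avOfRecord F N p.K k).avg U) *
      (chiSeqOfRecord F N ν τ.M g p.K k s'.init U * slotsOfRecord F N ν τ E w ppSel p g k s'.init U)) (fieldMeasure (F.P p.K) k (SU N)))
    {Fᵢ : (↥(Set.toFinite (bondsIn k (s'.Ω (k + 1))ᶜ)).toFinset → SU N) ×
        ({c : PBond (F.P p.K) (k + 1) // c ∉ (Set.toFinite (bondsIn (k + 1) (s'.Ω (k + 1))ᶜ)).toFinset} → SU N) → ℝ} (hFm : Measurable Fᵢ)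
    (hin : kernelTransport
        ((Measure.pi fun _ : ↥(Set.toFinite (bondsIn k (s'.Ω (k + 1))ᶜ)).toFinset => (HaarData.haar : Measure (SU N))).prod
          (Measure.pi fun _ : {b : PBond (F.P p.K) k // b ∉ (Set.toFinite (bondsIn k (s'.Ω (k + 1))ᶜ)).toFinset} => (HaarData.haar : Measure (SU N))))
        ((Measure.pi fun _ : ↥(Set.toFinite (bondsIn k (s'.Ω (k + 1))ᶜ)).toFinset => (HaarData.haar : Measure (SU N))).prod
          (Measure.pi fun _ : {c : PBond (F.P p.K) (k + 1) // c ∉ (Set.toFinite (bondsIn (k + 1) (s'.Ω (k + 1))ᶜ)).toFinset} =>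
            (HaarData.haar : Measure (SU N))))
        (fun q => (q.1, fun c : {c : PBond (F.P p.K) (k + 1) // c ∉ (Set.toFinite (bondsIn (k + 1) (s'.Ω (k + 1))ᶜ)).toFinset} =>
          (avOfRecord F N p.K k).avg
            ((MeasurableEquiv.piEquivPiSubtypeProd (fun _ : PBond (F.P p.K) k => SU N)
              (· ∈ (Set.toFinite (bondsIn k (s'.Ω (k + 1))ᶜ)).toFinset)).symm q) c))
        ((fun U => w p g k s' U ((avOfRecord F N p.K k).avg U) *
            (chiSeqOfRecord F N ν τ.M g p.K k s'.init U * slotsOfRecord F N ν τ E w ppSel p g k s'.init U)) ∘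
          ⇑(MeasurableEquiv.piEquivPiSubtypeProd (fun _ : PBond (F.P p.K) k => SU N)
            (· ∈ (Set.toFinite (bondsIn k (s'.Ω (k + 1))ᶜ)).toFinset)).symm)
      =ᵐ[(Measure.pi fun _ : ↥(Set.toFinite (bondsIn k (s'.Ω (k + 1))ᶜ)).toFinset => (HaarData.haar : Measure (SU N))).prod
          (Measure.pi fun _ : {c : PBond (F.P p.K) (k + 1) // c ∉ (Set.toFinite (bondsIn (k + 1) (s'.Ω (k + 1))ᶜ)).toFinset} =>
            (HaarData.haar : Measure (SU N)))] Fᵢ)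
    (Φ : MultiCfg (F.P p.K) (SU N) V → ℝ)
    (ωOf : (↥(Set.toFinite (bondsIn (k + 1) (s'.Ω (k + 1))ᶜ)).toFinset → SU N) ×
        ({c : PBond (F.P p.K) (k + 1) // c ∉ (Set.toFinite (bondsIn (k + 1) (s'.Ω (k + 1))ᶜ)).toFinset} → SU N) → MultiCfg (F.P p.K) (SU N) V)
    (hω : ∀ q, (fun b : ↥(genDataOfRecord F N V ν τ.M g p.K W s' S k).sV' => ((ωOf q) (k + 1)).1 (b : PBond (F.P p.K) (k + 1))) = q.1)
    (hinner : ∀ᵐ q ∂((Measure.pi fun _ : ↥(Set.toFinite (bondsIn (k + 1) (s'.Ω (k + 1))ᶜ)).toFinset => (HaarData.haar : Measure (SU N))).prod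
          (Measure.pi fun _ : {c : PBond (F.P p.K) (k + 1) // c ∉ (Set.toFinite (bondsIn (k + 1) (s'.Ω (k + 1))ᶜ)).toFinset} =>
            (HaarData.haar : Measure (SU N)))),
      ∀ y : ↥(Set.toFinite (bondsIn k (s'.Ω (k + 1))ᶜ)).toFinset → SU N,
        avgRestrOfRecord F N p.K k (Set.toFinite (bondsIn k (s'.Ω (k + 1))ᶜ)).toFinset (Set.toFinite (bondsIn (k + 1) (s'.Ω (k + 1))ᶜ)).toFinset y = q.1 →
        Fᵢ (y, q.2) =
          zetaOp (genDataOfRecord F N V ν τ.M g p.K W s' S k).ζ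
            (aOp k (genDataOfRecord F N V ν τ.M g p.K W s' S k).sA (genDataOfRecord F N V ν τ.M g p.K W s' S k).w Φ)
            (Function.update (ωOf q) k
              (Function.updateFinset ((ωOf q) k).1 (genDataOfRecord F N V ν τ.M g p.K W s' S k).sV y, ((ωOf q) k).2))) :
    (slotsTOfRecord F N ν τ E w ppSel p g (k + 1) s') ∘
        ⇑(MeasurableEquiv.piEquivPiSubtypeProd (fun _ : PBond (F.P p.K) (k + 1) => SU N)
          (· ∈ (Set.toFinite (bondsIn (k + 1) (s'.Ω (k + 1))ᶜ)).toFinset)).symm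
      =ᵐ[(Measure.pi fun _ : ↥(Set.toFinite (bondsIn (k + 1) (s'.Ω (k + 1))ᶜ)).toFinset => (HaarData.haar : Measure (SU N))).prod
          (Measure.pi fun _ : {c : PBond (F.P p.K) (k + 1) // c ∉ (Set.toFinite (bondsIn (k + 1) (s'.Ω (k + 1))ᶜ)).toFinset} =>
            (HaarData.haar : Measure (SU N)))]
        fun q => genOp k (genDataOfRecord F N V ν τ.M g p.K W s' S k) Φ (ωOf q) := by
  rw [slotsTOfRecord_succ]
  exact tstepOfRecord_comp_glue_ae_eq_genOp_genDataOfRecord ν τ.M w p g hkK hk (slotsOfRecord F N ν τ E w ppSel p g k) s' W S hG hFm hin Φ ωOf hω hinner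

/-- ★★★★★ **THE SAME IN THE STAGE-13 LETTERS OF (O3′)** (`…N11Sect3SupplyChainDefs.PresentChildObligations`, last conjunct, LEFT side VERBATIM: `slotsTOfRecord F N θ.ν θ.τ9
(EOfRecord₁₃ F N θ.toStage13Params) (wOfRecord₉ F N θ.toStage9Params) θ.ppSel p (gOfRecord₁₃ F N θ.toStage13Params p) (k+1) s`), at a v1.7 parameter `θ : Stage13HParams F N` — §2 instantiated;
weights `W`, branch `S`, operand `Φ`, configuration family `ωOf` arbitrary; `hG`, `hin`, `hω`, `hinner` displayed. [cite: Balaban1988Convergent, (2.18) p.257, (2.20)–(2.21) p.258, (3.24)–(3.25) p.270, §3 p.279 (bookkeeping)] -/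
theorem slotsTOfRecord₁₃H_succ_comp_glue_ae_eq_genOp_genDataOfRecord (θ : Stage13HParams F N) (p : B12.RunParams) {k : ℕ} (hkK : k < p.K)
    [DecidableEq (PBond (F.P p.K) k)] [DecidableEq (PBond (F.P p.K) (k + 1))] (hk : k + 1 ≤ (F.P p.K).m + (F.P p.K).K)
    (s' : SeqOfRecord F θ.ν θ.τ9.M (gOfRecord₁₃ F N θ.toStage13Params p) p.K (k + 1)) (W : TkWeights F N V p.K) (S : ℕ → Set (Site (F.P p.K) 0))
    (hG : Integrable (fun U => wOfRecord₉ F N θ.toStage9Params p (gOfRecord₁₃ F N θ.toStage13Params p) k s' U ((avOfRecord F N p.K k).avg U) *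
      (chiSeqOfRecord F N θ.ν θ.τ9.M (gOfRecord₁₃ F N θ.toStage13Params p) p.K k s'.init U *
        slotsOfRecord F N θ.ν θ.τ9 (EOfRecord₁₃ F N θ.toStage13Params) (wOfRecord₉ F N θ.toStage9Params) θ.ppSel p (gOfRecord₁₃ F N θ.toStage13Params p) k s'.init U))
      (fieldMeasure (F.P p.K) k (SU N)))
    {Fᵢ : (↥(Set.toFinite (bondsIn k (s'.Ω (k + 1))ᶜ)).toFinset → SU N) ×
        ({c : PBond (F.P p.K) (k + 1) // c ∉ (Set.toFinite (bondsIn (k + 1) (s'.Ω (k + 1))ᶜ)).toFinset} → SU N) → ℝ} (hFm : Measurable Fᵢ)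
    (hin : kernelTransport
        ((Measure.pi fun _ : ↥(Set.toFinite (bondsIn k (s'.Ω (k + 1))ᶜ)).toFinset => (HaarData.haar : Measure (SU N))).prod
          (Measure.pi fun _ : {b : PBond (F.P p.K) k // b ∉ (Set.toFinite (bondsIn k (s'.Ω (k + 1))ᶜ)).toFinset} => (HaarData.haar : Measure (SU N))))
        ((Measure.pi fun _ : ↥(Set.toFinite (bondsIn k (s'.Ω (k + 1))ᶜ)).toFinset => (HaarData.haar : Measure (SU N))).prod
          (Measure.pi fun _ : {c : PBond (F.P p.K) (k + 1) // c ∉ (Set.toFinite (bondsIn (k + 1) (s'.Ω (k + 1))ᶜ)).toFinset} =>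
            (HaarData.haar : Measure (SU N))))
        (fun q => (q.1, fun c : {c : PBond (F.P p.K) (k + 1) // c ∉ (Set.toFinite (bondsIn (k + 1) (s'.Ω (k + 1))ᶜ)).toFinset} =>
          (avOfRecord F N p.K k).avg
            ((MeasurableEquiv.piEquivPiSubtypeProd (fun _ : PBond (F.P p.K) k => SU N)
              (· ∈ (Set.toFinite (bondsIn k (s'.Ω (k + 1))ᶜ)).toFinset)).symm q) c))
        ((fun U => wOfRecord₉ F N θ.toStage9Params p (gOfRecord₁₃ F N θ.toStage13Params p) k s' U ((avOfRecord F N p.K k).avg U) *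
            (chiSeqOfRecord F N θ.ν θ.τ9.M (gOfRecord₁₃ F N θ.toStage13Params p) p.K k s'.init U *
              slotsOfRecord F N θ.ν θ.τ9 (EOfRecord₁₃ F N θ.toStage13Params) (wOfRecord₉ F N θ.toStage9Params) θ.ppSel p
                (gOfRecord₁₃ F N θ.toStage13Params p) k s'.init U)) ∘
          ⇑(MeasurableEquiv.piEquivPiSubtypeProd (fun _ : PBond (F.P p.K) k => SU N)
            (· ∈ (Set.toFinite (bondsIn k (s'.Ω (k + 1))ᶜ)).toFinset)).symm)
      =ᵐ[(Measure.pi fun _ : ↥(Set.toFinite (bondsIn k (s'.Ω (k + 1))ᶜ)).toFinset => (HaarData.haar : Measure (SU N))).prod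
          (Measure.pi fun _ : {c : PBond (F.P p.K) (k + 1) // c ∉ (Set.toFinite (bondsIn (k + 1) (s'.Ω (k + 1))ᶜ)).toFinset} =>
            (HaarData.haar : Measure (SU N)))] Fᵢ)
    (Φ : MultiCfg (F.P p.K) (SU N) V → ℝ)
    (ωOf : (↥(Set.toFinite (bondsIn (k + 1) (s'.Ω (k + 1))ᶜ)).toFinset → SU N) ×
        ({c : PBond (F.P p.K) (k + 1) // c ∉ (Set.toFinite (bondsIn (k + 1) (s'.Ω (k + 1))ᶜ)).toFinset} → SU N) → MultiCfg (F.P p.K) (SU N) V)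
    (hω : ∀ q, (fun b : ↥(genDataOfRecord F N V θ.ν θ.τ9.M (gOfRecord₁₃ F N θ.toStage13Params p) p.K W s' S k).sV' =>
      ((ωOf q) (k + 1)).1 (b : PBond (F.P p.K) (k + 1))) = q.1)
    (hinner : ∀ᵐ q ∂((Measure.pi fun _ : ↥(Set.toFinite (bondsIn (k + 1) (s'.Ω (k + 1))ᶜ)).toFinset => (HaarData.haar : Measure (SU N))).prod
          (Measure.pi fun _ : {c : PBond (F.P p.K) (k + 1) // c ∉ (Set.toFinite (bondsIn (k + 1) (s'.Ω (k + 1))ᶜ)).toFinset} =>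
            (HaarData.haar : Measure (SU N)))),
      ∀ y : ↥(Set.toFinite (bondsIn k (s'.Ω (k + 1))ᶜ)).toFinset → SU N,
        avgRestrOfRecord F N p.K k (Set.toFinite (bondsIn k (s'.Ω (k + 1))ᶜ)).toFinset (Set.toFinite (bondsIn (k + 1) (s'.Ω (k + 1))ᶜ)).toFinset y = q.1 →
        Fᵢ (y, q.2) =
          zetaOp (genDataOfRecord F N V θ.ν θ.τ9.M (gOfRecord₁₃ F N θ.toStage13Params p) p.K W s' S k).ζ
            (aOp k (genDataOfRecord F N V θ.ν θ.τ9.M (gOfRecord₁₃ F N θ.toStage13Params p) p.K W s' S k).sA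
              (genDataOfRecord F N V θ.ν θ.τ9.M (gOfRecord₁₃ F N θ.toStage13Params p) p.K W s' S k).w Φ)
            (Function.update (ωOf q) k
              (Function.updateFinset ((ωOf q) k).1 (genDataOfRecord F N V θ.ν θ.τ9.M (gOfRecord₁₃ F N θ.toStage13Params p) p.K W s' S k).sV y,
                ((ωOf q) k).2))) :
    (slotsTOfRecord F N θ.ν θ.τ9 (EOfRecord₁₃ F N θ.toStage13Params) (wOfRecord₉ F N θ.toStage9Params) θ.ppSel p (gOfRecord₁₃ F N θ.toStage13Params p) (k + 1) s') ∘
        ⇑(MeasurableEquiv.piEquivPiSubtypeProd (fun _ : PBond (F.P p.K) (k + 1) => SU N)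
          (· ∈ (Set.toFinite (bondsIn (k + 1) (s'.Ω (k + 1))ᶜ)).toFinset)).symm
      =ᵐ[(Measure.pi fun _ : ↥(Set.toFinite (bondsIn (k + 1) (s'.Ω (k + 1))ᶜ)).toFinset => (HaarData.haar : Measure (SU N))).prod
          (Measure.pi fun _ : {c : PBond (F.P p.K) (k + 1) // c ∉ (Set.toFinite (bondsIn (k + 1) (s'.Ω (k + 1))ᶜ)).toFinset} =>
            (HaarData.haar : Measure (SU N)))]
        fun q => genOp k (genDataOfRecord F N V θ.ν θ.τ9.M (gOfRecord₁₃ F N θ.toStage13Params p) p.K W s' S k) Φ (ωOf q) :=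
  slotsTOfRecord_succ_comp_glue_ae_eq_genOp_genDataOfRecord θ.ν θ.τ9 (EOfRecord₁₃ F N θ.toStage13Params) (wOfRecord₉ F N θ.toStage9Params) θ.ppSel p
    (gOfRecord₁₃ F N θ.toStage13Params p) hkK hk s' W S hG hFm hin Φ ωOf hω hinner

end Junction

end Summit.QuantumFields.YangMills.Theorems.BalabanUVNodesN11TStepGenOpJunction

end
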